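import Summits.KontsevichZagierPeriods.Zeta5Search.Barrier.ConeGammaTranslateChamberWeights

/-!
# ζ(5) search — BARRIER: NEAR THE CLOSED ORBIT THE MARGIN IS A RATE-SEPARATION CERTIFICATE — 28 + 378 inequalities on the rates
# of the translate replace P2 g40's margin hypotheses (file (4) of «THE CLOSED-ORBIT LIMIT»)

HONEST FRAMING (cell `pub-zeta5`): systematic search; no irrationality claim unless kernel-certified. MODEL objects
under Brown–Zudilin's (28)+(30) accounting ([BZ22] = arXiv:2210.03391; (28) observed, not proved); nothing here is a
statement about `ζ(5)`, any `γ` of record, the cone's supremum (C2 OPEN) or any value at a named direction (DATA of the cell);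
NO cancellation is quantified; S-E / (TD_A) stay CONJECTURED; records in print UNMOVED. Prover P2 g41 (item «THE CLOSED-ORBIT
LIMIT», file (4); plan INBOX 2026-08-28). Sources: P2 g40 `ConeGammaTranslateGradient` (the margin hypotheses `hsep` — the crossing
times `s_{k,z} = (z − φ_kδ)/h_k(a)` of distinct `(k,z)` are `r`-separated, for ALL integers `z, z'` — and `hend` — none within `r` of
`0`), files (1)–(2) of this item.

THE POINT. P2 g40's margin is an infinite family of inequalities (all `z, z' ∈ ℤ`), discharged for generic `δ` by a
non-constructive distance-to-`ℤ` argument (`exists_margin_of_generic`). NEAR THE CLOSED ORBIT it is a FINITE check on the 28 rates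
`ρ_k = φ_k(δ)/h_k(a)`:
* **`margin_of_rate_sep`** — if `|ρ_k| ≤ ρ̄`, `r ≤ |ρ_k|` (28 inequalities), `r ≤ |ρ_k − ρ_l|` for `k ≠ l` (378 inequalities) and
  `(r + 2ρ̄)·T·x_max(a)² ≤ 1`, then `hsep` ∧ `hend` hold with THIS `r` (two crossings at the same junction are separated by their
  rate difference; crossings at different junctions `z/h_k ≠ z'/h_l` are `≥ T/(N_k N_l) = 1/(T·h_k·h_l) ≥ 1/(T·x_max²)` apart before
  the translate moves them by at most `2ρ̄`; `T·x_max ≥ T·h_k = N_k ≥ 1` handles `hend`);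
* **`jumpMass_eq_canonical_weight_of_rate_sep`**, **`fderiv_translateIntegral_eq_chamber_of_rate_sep`** — files (2)'s closed-orbit
  limit and derivative formula with the margin REPLACED by the rate-separation certificate (coherence `(2ρ̄ + r/2)·x_max < min(1,
  wallDist a T)` as before): every hypothesis on `δ` is now a finite list of inequalities on its 28 rates — what a checker verifies.
NOT here (honest): any instance at a named direction; the margin away from the coherence ball (there the resonances are genuinely
arithmetic, P2 g40 file (4)); `Φ`, `γ`, C2, S-E, `ζ(5)`.
-/

noncomputable section

open Set MeasureTheory Finset
open scoped Topology

namespace Summit.KontsevichZagierPeriods.Zeta5Search.Barrier.ConeGamma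

/-! ### Junctions of different forms are `1/(T·x_max²)` apart -/

/-- **Distinct junction times are `≥ 1/(T·h_k·h_l)` apart**: with `T·h_k = N_k`, `T·h_l = N_l` positive integers,
`z/h_k − z'/h_l = T·(z·N_l − z'·N_k)/(N_k·N_l)`, so if it is non-zero it is at least `T/(N_k N_l) = 1/(T·h_k·h_l)` in size. -/
theorem junction_gap {a : Dir} (hpos : ∀ k, 0 < h28 a k) {T : ℝ} (hT : 0 < T)
    (hper : ∀ k : Fin 28, ∃ z : ℤ, T * h28 a k = z) (k l : Fin 28) (z z' : ℤ)
    (hne : (z : ℝ) / h28 a k ≠ (z' : ℝ) / h28 a l) :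
    1 / (T * h28 a k * h28 a l) ≤ |(z : ℝ) / h28 a k - (z' : ℝ) / h28 a l| := by
  have hk := hpos k
  have hl := hpos l
  obtain ⟨Nk, hNk⟩ := hper k
  obtain ⟨Nl, hNl⟩ := hper l
  have e : (z : ℝ) / h28 a k - (z' : ℝ) / h28 a l = ((z * Nl - z' * Nk : ℤ) : ℝ) / (T * h28 a k * h28 a l) := by
    push_cast
    rw [← hNk, ← hNl]
    field_simp
  have hD : 0 < T * h28 a k * h28 a l := by positivity
  rw [e, abs_div, abs_of_pos hD, div_le_div_iff_of_pos_right hD]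
  have hnz : (z * Nl - z' * Nk : ℤ) ≠ 0 := by
    intro h0
    apply hne
    have : (z : ℝ) / h28 a k - (z' : ℝ) / h28 a l = 0 := by rw [e, h0]; simp
    linarith
  have h1 : (1 : ℤ) ≤ |z * Nl - z' * Nk| := Int.one_le_abs hnz
  rw [← Int.cast_abs]
  exact_mod_cast h1

/-- `T·x_max(a) ≥ 1` (indeed `T·h_k(a) = N_k` is a positive integer for every form). -/
theorem one_le_T_mul_xMax {a : Dir} (hpos : ∀ k, 0 < h28 a k) {T : ℝ} (hT : 0 < T)
    (hper : ∀ k : Fin 28, ∃ z : ℤ, T * h28 a k = z) : 1 ≤ T * xMax a := by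
  obtain ⟨N, hN⟩ := hper 0
  have h0 : (0 : ℝ) < N := by rw [← hN]; exact mul_pos hT (hpos 0)
  have h1 : (1 : ℝ) ≤ N := by
    have : (0 : ℤ) < N := by exact_mod_cast h0
    exact_mod_cast this
  calc (1 : ℝ) ≤ N := h1
    _ = T * h28 a 0 := hN.symm
    _ ≤ T * xMax a := mul_le_mul_of_nonneg_left (le_xMax a 0) hT.le

/-! ### The rate-separation certificate gives the margin -/

/-- **NEAR THE CLOSED ORBIT THE MARGIN IS A RATE-SEPARATION CERTIFICATE.** All 28 forms of `a` positive, `T > 0` a period. If the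
rates `ρ_k = φ_k(δ)/h_k(a)` of the translate `δ` satisfy `|ρ_k| ≤ ρ̄`, `r ≤ |ρ_k|`, `r ≤ |ρ_k − ρ_l|` (`k ≠ l`) and
`(r + 2ρ̄)·T·x_max(a)² ≤ 1`, then P2 g40's margin hypotheses hold with this `r`: the crossing times of distinct `(k,z) ≠ (k',z')` are
`r`-separated for ALL integers `z, z'`, and none is within `r` of `0`. -/
theorem margin_of_rate_sep {a : Dir} (hpos : ∀ k, 0 < h28 a k) {T : ℝ} (hT : 0 < T)
    (hper : ∀ k : Fin 28, ∃ z : ℤ, T * h28 a k = z) {δ : Fin 8 → ℝ} {ρb r : ℝ}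
    (hρ : ∀ k, |phiForm δ k / h28 a k| ≤ ρb) (hr0 : ∀ k, r ≤ |phiForm δ k / h28 a k|)
    (hrs : ∀ k l : Fin 28, k ≠ l → r ≤ |phiForm δ k / h28 a k - phiForm δ l / h28 a l|)
    (hrT : (r + 2 * ρb) * T * xMax a ^ 2 ≤ 1) :
    (∀ (k k' : Fin 28) (z z' : ℤ), (k ≠ k' ∨ z ≠ z') →
        r ≤ |((z : ℝ) - phiForm δ k) / h28 a k - ((z' : ℝ) - phiForm δ k') / h28 a k'|) ∧
      (∀ (k : Fin 28) (z : ℤ), r ≤ |((z : ℝ) - phiForm δ k) / h28 a k|) := by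
  have hx : 0 < xMax a := xMax_pos hpos
  have hTx : 1 ≤ T * xMax a := one_le_T_mul_xMax hpos hT hper
  have hρb : 0 ≤ ρb := (abs_nonneg _).trans (hρ 0)
  -- the basic gap `1/(T·x_max²) ≥ r + 2ρ̄`
  have hgap : r + 2 * ρb ≤ 1 / (T * xMax a ^ 2) := by
    rw [le_div_iff₀ (by positivity)]; linarith
  have hgap' : ∀ k l : Fin 28, 1 / (T * xMax a ^ 2) ≤ 1 / (T * h28 a k * h28 a l) := fun k l => by
    have := hpos k; have := hpos l
    apply one_div_le_one_div_of_le (by positivity)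
    have h1 := le_xMax a k; have h2 := le_xMax a l
    calc T * h28 a k * h28 a l ≤ T * xMax a * xMax a := by gcongr
      _ = T * xMax a ^ 2 := by ring
  refine ⟨fun k k' z z' hne => ?_, fun k z => ?_⟩
  · have ek : ((z : ℝ) - phiForm δ k) / h28 a k = (z : ℝ) / h28 a k - phiForm δ k / h28 a k := sub_div _ _ _
    have ek' : ((z' : ℝ) - phiForm δ k') / h28 a k' = (z' : ℝ) / h28 a k' - phiForm δ k' / h28 a k' := sub_div _ _ _
    rw [ek, ek']
    by_cases hj : (z : ℝ) / h28 a k = (z' : ℝ) / h28 a k'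
    · -- same junction: the two forms are distinct and their rates are `r`-separated
      have hkk' : k ≠ k' := by
        rintro rfl
        rcases hne with h | h
        · exact h rfl
        · apply h
          have := congrArg (· * h28 a k) hj
          simp only [div_mul_cancel₀ _ (hpos k).ne'] at this
          exact_mod_cast this
      rw [hj, show (z' : ℝ) / h28 a k' - phiForm δ k / h28 a k - ((z' : ℝ) / h28 a k' - phiForm δ k' / h28 a k') =
        -(phiForm δ k / h28 a k - phiForm δ k' / h28 a k') by ring, abs_neg]
      exact hrs k k' hkk'
    · -- different junctions: at least `1/(T·x_max²)` apart, moved by at most `2ρ̄`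
      have hg := (hgap' k k').trans (junction_gap hpos hT hper k k' z z' hj)
      have h1 := hρ k
      have h2 := hρ k'
      have htri : |(z : ℝ) / h28 a k - (z' : ℝ) / h28 a k'| ≤
          |(z : ℝ) / h28 a k - phiForm δ k / h28 a k - ((z' : ℝ) / h28 a k' - phiForm δ k' / h28 a k')| +
            (|phiForm δ k / h28 a k| + |phiForm δ k' / h28 a k'|) := by
        have e : (z : ℝ) / h28 a k - (z' : ℝ) / h28 a k' =
            ((z : ℝ) / h28 a k - phiForm δ k / h28 a k - ((z' : ℝ) / h28 a k' - phiForm δ k' / h28 a k')) +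
              (phiForm δ k / h28 a k - phiForm δ k' / h28 a k') := by ring
        rw [e]
        exact (abs_add_le _ _).trans (by gcongr; exact abs_sub _ _)
      linarith
  · have ek : ((z : ℝ) - phiForm δ k) / h28 a k = (z : ℝ) / h28 a k - phiForm δ k / h28 a k := sub_div _ _ _
    rw [ek]
    by_cases hz : z = 0
    · rw [hz, Int.cast_zero, zero_div, zero_sub, abs_neg]; exact hr0 k
    · -- `|z/h_k| ≥ 1/x_max ≥ 1/(T x_max²) ≥ r + 2ρ̄`
      have hk := hpos k
      have hz1 : 1 / xMax a ≤ |(z : ℝ) / h28 a k| := by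
        rw [abs_div, abs_of_pos hk]
        have h1 : (1 : ℝ) ≤ |(z : ℝ)| := by
          rw [← Int.cast_abs]; exact_mod_cast Int.one_le_abs hz
        calc 1 / xMax a ≤ 1 / h28 a k := one_div_le_one_div_of_le hk (le_xMax a k)
          _ ≤ |(z : ℝ)| / h28 a k := by gcongr
      have hz2 : 1 / (T * xMax a ^ 2) ≤ 1 / xMax a := by
        apply one_div_le_one_div_of_le hx
        calc xMax a = 1 * xMax a := (one_mul _).symm
          _ ≤ T * xMax a * xMax a := by gcongr
          _ = T * xMax a ^ 2 := by ring
      have h1 := hρ k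
      have htri : |(z : ℝ) / h28 a k| ≤ |(z : ℝ) / h28 a k - phiForm δ k / h28 a k| + |phiForm δ k / h28 a k| := by
        have := abs_add_le ((z : ℝ) / h28 a k - phiForm δ k / h28 a k) (phiForm δ k / h28 a k)
        rwa [sub_add_cancel] at this
      linarith

/-! ### The closed-orbit limit from the rate certificate -/

/-- **THE CLOSED-ORBIT LIMIT FROM THE RATE CERTIFICATE**: `J_k(δ) = F(P≤(k)) − F(P<(k))` for every `k`, with file (2)'s margin
hypotheses replaced by `r ≤ |ρ_k|`, `r ≤ |ρ_k − ρ_l|`, `(r + 2ρ̄)·T·x_max² ≤ 1` (and coherence `(2ρ̄ + r/2)·x_max < min(1, wallDist a T)`,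
`0 < r` as before). -/
theorem jumpMass_eq_canonical_weight_of_rate_sep {a : Dir} (hpos : ∀ k, 0 < h28 a k) {T : ℝ} (hT : 0 < T)
    (hper : ∀ k : Fin 28, ∃ z : ℤ, T * h28 a k = z) {F : Finset (Fin 28) → ℝ}
    (hF : ∀ A, F A = ∑ m ∈ Finset.range ((bkpts a T).card - 1), ((patternN a (bkpt a T m) A : ℤ) : ℝ))
    {δ : Fin 8 → ℝ} {ρb r : ℝ} (hr : 0 < r) (hρ : ∀ k, |phiForm δ k / h28 a k| ≤ ρb)
    (hr0 : ∀ k, r ≤ |phiForm δ k / h28 a k|)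
    (hrs : ∀ k l : Fin 28, k ≠ l → r ≤ |phiForm δ k / h28 a k - phiForm δ l / h28 a l|)
    (hrT : (r + 2 * ρb) * T * xMax a ^ 2 ≤ 1) (hc1 : (2 * ρb + r / 2) * xMax a < 1)
    (hc2 : (2 * ρb + r / 2) * xMax a < wallDist a T) (k : Fin 28) :
    ((∑ z ∈ Finset.Ioc ⌊phiForm δ k⌋ (⌊phiForm δ k⌋ + ⌊T * h28 a k⌋),
        (torusN ((((z : ℝ) - phiForm δ k) / h28 a k) • sParam a + δ) -
          torusN ((((z : ℝ) - phiForm δ k) / h28 a k - r / 2) • sParam a + δ)) : ℤ) : ℝ) =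
      F (Finset.univ.filter fun l => phiForm δ k / h28 a k ≤ phiForm δ l / h28 a l) -
        F (Finset.univ.filter fun l => phiForm δ k / h28 a k < phiForm δ l / h28 a l) := by
  obtain ⟨hsep, hend⟩ := margin_of_rate_sep hpos hT hper hρ hr0 hrs hrT
  exact jumpMass_eq_canonical_weight hpos hT hper hF hr hsep hend hρ hc1 hc2 k

/-- **THE DERIVATIVE IS THE CHAMBER FUNCTIONAL FROM THE RATE CERTIFICATE**: `P` is differentiable at `δ` with
`fderiv ℝ P δ Δ = Σ_k W_k(δ)·φ_k(Δ)/h_k(a)`, and `cuspSlope a T δ = fderiv ℝ P δ δ`, under the same finite list of inequalities on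
the 28 rates of `δ`. -/
theorem fderiv_translateIntegral_eq_chamber_of_rate_sep {a : Dir} (hpos : ∀ k, 0 < h28 a k) {T : ℝ} (hT : 0 < T)
    (hper : ∀ k : Fin 28, ∃ z : ℤ, T * h28 a k = z) {F : Finset (Fin 28) → ℝ}
    (hF : ∀ A, F A = ∑ m ∈ Finset.range ((bkpts a T).card - 1), ((patternN a (bkpt a T m) A : ℤ) : ℝ))
    {δ : Fin 8 → ℝ} {ρb r : ℝ} (hr : 0 < r) (hρ : ∀ k, |phiForm δ k / h28 a k| ≤ ρb)
    (hr0 : ∀ k, r ≤ |phiForm δ k / h28 a k|)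
    (hrs : ∀ k l : Fin 28, k ≠ l → r ≤ |phiForm δ k / h28 a k - phiForm δ l / h28 a l|)
    (hrT : (r + 2 * ρb) * T * xMax a ^ 2 ≤ 1) (hc1 : (2 * ρb + r / 2) * xMax a < 1)
    (hc2 : (2 * ρb + r / 2) * xMax a < wallDist a T) :
    (DifferentiableAt ℝ (translateIntegral a T) δ ∧ ∀ Δ : Fin 8 → ℝ, fderiv ℝ (translateIntegral a T) δ Δ =
      ∑ k, (F (Finset.univ.filter fun l => phiForm δ k / h28 a k ≤ phiForm δ l / h28 a l) -
          F (Finset.univ.filter fun l => phiForm δ k / h28 a k < phiForm δ l / h28 a l)) *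
        (phiForm Δ k / h28 a k)) ∧
      cuspSlope a T δ = fderiv ℝ (translateIntegral a T) δ δ := by
  obtain ⟨hsep, hend⟩ := margin_of_rate_sep hpos hT hper hρ hr0 hrs hrT
  exact ⟨fderiv_translateIntegral_eq_chamber hpos hT hper hF hr hsep hend hρ hc1 hc2,
    cuspSlope_self_eq_fderiv hpos hT hper hr hsep hend hρ hc1 hc2⟩

end Summit.KontsevichZagierPeriods.Zeta5Search.Barrier.ConeGamma

end
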